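import Summits.RiemannHypothesis.RiemannHypothesis.Theorems.UniversalFactorLaguerreLift

/-!
# RiemannHypothesis / UniversalFactor — real-rootedness propagates up the universal-factor order

Route `RiemannHypothesis/UniversalFactor`, item `MixedFactorReduction` (stmt-RiemannHypothesis-2580).
With `Φ = deBruijnPhi` and, for a kernel multiplier `m : ℝ → ℝ`,
`deBruijnHDiv m z = ∫₀^∞ (Φ(u)/m(u)) cos(zu) du`, this file proves, sorry-free and unconditionally,
for every CONTINUOUS multiplier `m ≥ 1` (the class containing all finite universal factors
`e^{tu²} ∏_{b ∈ s} (1 + u²/b²)`, `t ≥ 0`):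

* `UniversalFactor.isAdmissible_divKernel`, `UniversalFactor.trigIntegral_divKernel`,
  `UniversalFactor.exists_growth_deBruijnHDiv`: the even kernel `Φ(|s|)/m(|s|)` is de Bruijn-admissible,
  its trigonometric integral is `2 · deBruijnHDiv m`, hence `deBruijnHDiv m` is real entire of
  order `< 2` (de Bruijn 1950, Thm. 10);
* `UniversalFactor.deBruijnHDiv_zero_ne_zero`: `deBruijnHDiv m 0 = ∫₀^∞ Φ/m > 0`, so the transform is `≢ 0`;
* `UniversalFactor.deBruijnHDiv_mul_laplace_sub_deriv_deriv`: the ODE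
  `(1 − D²/b²) deBruijnHDiv (m · (1 + u²/b²)) = deBruijnHDiv m`;
* `UniversalFactor.hasOnlyRealZeros_deBruijnHDiv_of_mul_laplace` — **the Laguerre step up the
  order**: if `deBruijnHDiv (m · (1 + u²/b²))` has only real zeros then so has `deBruijnHDiv m`
  (two Hadamard-free Laguerre steps `D ± b`, `UniversalFactor.laguerre_step`);
* `UniversalFactor.hasOnlyRealZeros_deBruijnHDiv_of_mul_exp` — **the Gaussian step up the order**:
  if `deBruijnHDiv (m · e^{tu²})` (`t ≥ 0`) has only real zeros then so has `deBruijnHDiv m`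
  (de Bruijn 1950, Thm. 13 with `Δ = 0`: `DeBruijn1950.rootsInStrip_zero_gaussian`, `λ = √(2t)`);
* `UniversalFactor.mixedFactorReduction` — the route decl **`MixedFactorReduction`**: for `t ≥ 0`
  and a multiset `s ∋ a`, if the transform of `e^{−tu²} Φ(u)/∏_{b∈s}(1 + u²/b²)` has only real
  zeros then so has `F_a = deBruijnHDiv (1 + u²/a²)` (Gaussian step, then one Laguerre step per
  element of `s ∖ {a}`, by multiset induction).

References: N. G. de Bruijn, Duke Math. J. 17 (1950), Thms. 10, 13; E. Laguerre, Œuvres I,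
pp. 167–180; D. A. Cardon, Proc. AMS 130 (2002), §3.
-/

noncomputable section

namespace Summit.RiemannHypothesis.RiemannHypothesis.Theorems

open MeasureTheory Set Filter
open Literature.NumberTheory.LFunctions Literature.Analysis.Complex
open Summit.RiemannHypothesis.RiemannHypothesis.Theses

/-! ## Multipliers `m ≥ 1`: admissibility of the kernel `Φ(|s|)/m(|s|)`, growth of `deBruijnHDiv m` -/

/-- A continuous multiplier `m ≥ 1` is `IsDivAdmissible` (with `C = 1`, `T = 0`). [folklore] -/
theorem UniversalFactor.isDivAdmissible_of_one_le {m : ℝ → ℝ} (hmc : Continuous m)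
    (hm1 : ∀ u, 1 ≤ m u) : IsDivAdmissible m := by
  refine ⟨hmc.aestronglyMeasurable, 1, 0, zero_le_one, fun u _ ↦ ?_⟩
  rw [abs_of_pos (by linarith [hm1 u]), zero_mul, Real.exp_zero, mul_one]
  exact inv_le_one_of_one_le₀ (hm1 u)

/-- Pointwise domination of the kernel `Φ(|s|)/m(|s|)` by de Bruijn's kernel `F_0(s) = Φ(|s|)`
when `m ≥ 1`. [folklore] -/
theorem UniversalFactor.norm_divKernel_le {m : ℝ → ℝ} (hm1 : ∀ u, 1 ≤ m u) (s : ℝ) :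
    ‖(((Newman.evenPhi s / m |s| : ℝ) : ℂ))‖ ≤ ‖deBruijnKernel 0 s‖ := by
  have hm_pos : 0 < m |s| := by linarith [hm1 |s|]
  rw [norm_deBruijnKernel, zero_mul, Real.exp_zero, one_mul, Complex.norm_real, Real.norm_eq_abs,
    abs_of_nonneg (div_nonneg (Newman.evenPhi_nonneg s) hm_pos.le)]
  exact div_le_self (Newman.evenPhi_nonneg s) (hm1 _)

/-- **The kernel `Φ(|s|)/m(|s|)` is de Bruijn-admissible** for continuous `m ≥ 1` (integrable,
`K(−s) = K(s)^*` — it is real and even —, and `K(s) = O(e^{−|s|³})`), being dominated by the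
admissible kernel `F_0`. [cite: Bruijn1950, Thm. 10] -/
theorem UniversalFactor.isAdmissible_divKernel {m : ℝ → ℝ} (hmc : Continuous m)
    (hm1 : ∀ u, 1 ≤ m u) :
    DeBruijn1950.IsAdmissible (fun s : ℝ ↦ ((Newman.evenPhi s / m |s| : ℝ) : ℂ)) := by
  have hm_pos : ∀ s : ℝ, 0 < m s := fun s ↦ by linarith [hm1 s]
  have hcont : Continuous fun s : ℝ ↦ ((Newman.evenPhi s / m |s| : ℝ) : ℂ) :=
    Complex.continuous_ofReal.comp
      (Newman.continuous_evenPhi.div (hmc.comp continuous_abs) fun s ↦ (hm_pos _).ne')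
  obtain ⟨C, hC, hle⟩ := exists_norm_deBruijnKernel_le 0
  refine ⟨?_, fun s ↦ ?_, ⟨3, C, by norm_num, Eventually.of_forall fun s ↦ ?_⟩⟩
  · exact (integrable_deBruijnKernel 0).norm.mono' hcont.aestronglyMeasurable
      (Eventually.of_forall fun s ↦ UniversalFactor.norm_divKernel_le hm1 s)
  · simp only [Newman.evenPhi_neg, abs_neg, Complex.conj_ofReal]
  · have h1 : Real.exp (-|s|) ≤ 1 := Real.exp_le_one_iff.2 (neg_nonpos.2 (abs_nonneg s))
    calc ‖(((Newman.evenPhi s / m |s| : ℝ) : ℂ))‖ ≤ ‖deBruijnKernel 0 s‖ :=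
          UniversalFactor.norm_divKernel_le hm1 s
      _ ≤ C * Real.exp (-|s|) * Real.exp (-|s| ^ 3) := hle s
      _ ≤ C * 1 * Real.exp (-|s| ^ 3) :=
          mul_le_mul_of_nonneg_right (mul_le_mul_of_nonneg_left h1 hC) (Real.exp_pos _).le
      _ = C * Real.exp (-|s| ^ (3 : ℝ)) := by
          rw [mul_one, show (3 : ℝ) = ((3 : ℕ) : ℝ) by norm_num, Real.rpow_natCast]

/-- **`∫_ℝ Φ(|s|)/m(|s|) e^{izs} ds = 2 · deBruijnHDiv m z`**: the divided transform as a de Bruijn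
trigonometric integral (fold `ℝ` onto `(0, ∞)`, `e^{izs} + e^{−izs} = 2cos(zs)`). [folklore] -/
theorem UniversalFactor.trigIntegral_divKernel {m : ℝ → ℝ} (hmc : Continuous m)
    (hm1 : ∀ u, 1 ≤ m u) (z : ℂ) :
    trigIntegral (fun s : ℝ ↦ ((Newman.evenPhi s / m |s| : ℝ) : ℂ)) z = 2 * deBruijnHDiv m z := by
  have hF := UniversalFactor.isAdmissible_divKernel hmc hm1
  set k : ℝ → ℂ := fun s ↦ ((Newman.evenPhi s / m |s| : ℝ) : ℂ) *
    Complex.exp (Complex.I * z * s) with hk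
  have hki : Integrable k :=
    integrable_mul_cexp_of_exp_moment hF.integrable.aestronglyMeasurable z
      (hF.integrable_norm_mul_exp ‖z‖)
  have h1 : trigIntegral (fun s : ℝ ↦ ((Newman.evenPhi s / m |s| : ℝ) : ℂ)) z =
      (∫ s in Iic (0 : ℝ), k s) + ∫ s in Ioi (0 : ℝ), k s := by
    rw [trigIntegral, intervalIntegral.integral_Iic_add_Ioi hki.integrableOn hki.integrableOn]
  have h2 : ∫ s in Iic (0 : ℝ), k s = ∫ s in Ioi (0 : ℝ), k (-s) := by
    rw [integral_comp_neg_Ioi, neg_zero]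
  have hki' : IntegrableOn (fun s ↦ k (-s)) (Ioi 0) := hki.comp_neg.integrableOn
  rw [h1, h2, ← integral_add hki' hki.integrableOn, deBruijnHDiv, ← integral_const_mul]
  refine setIntegral_congr_fun measurableSet_Ioi fun s (hs : 0 < s) ↦ ?_
  have hcos : Complex.exp (Complex.I * z * ((-s : ℝ) : ℂ)) + Complex.exp (Complex.I * z * s) =
      2 * Complex.cos (z * s) := by
    rw [Complex.two_cos]
    push_cast
    ring_nf
  simp only [hk]
  rw [Newman.evenPhi_neg, abs_neg, ← mul_add, hcos, Newman.evenPhi_of_nonneg hs.le, abs_of_pos hs]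
  push_cast
  ring

/-- **`deBruijnHDiv m` is a real entire function of order `< 2`** for continuous `m ≥ 1`
(de Bruijn 1950, Thm. 10, applied to the admissible kernel `Φ(|s|)/m(|s|)`). [cite: Bruijn1950, Thm. 10] -/
theorem UniversalFactor.exists_growth_deBruijnHDiv {m : ℝ → ℝ} (hmc : Continuous m)
    (hm1 : ∀ u, 1 ≤ m u) :
    ∃ ρ C : ℝ, 0 ≤ ρ ∧ ρ < 2 ∧ ∀ z, ‖deBruijnHDiv m z‖ ≤ C * Real.exp (‖z‖ ^ ρ) := by
  obtain ⟨ρ, C₀, hρ0, hρ, h⟩ := (UniversalFactor.isAdmissible_divKernel hmc hm1).exists_order_bound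
  refine ⟨ρ, C₀ / 2, hρ0, hρ, fun z ↦ ?_⟩
  have h1 := h z
  rw [UniversalFactor.trigIntegral_divKernel hmc hm1, norm_mul, Complex.norm_two] at h1
  linarith

/-- **Non-degeneracy**: `deBruijnHDiv m 0 = ∫₀^∞ Φ(u)/m(u) du > 0` (`Φ > 0`, `m > 0`), so the
transform is not identically zero. [folklore] -/
theorem UniversalFactor.deBruijnHDiv_zero_ne_zero {m : ℝ → ℝ} (hmc : Continuous m)
    (hm1 : ∀ u, 1 ≤ m u) : deBruijnHDiv m 0 ≠ 0 := by
  have hm_pos : ∀ u, 0 < m u := fun u ↦ by linarith [hm1 u]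
  have hintR : IntegrableOn (fun u : ℝ ↦ deBruijnPhi u / m u) (Ioi 0) := by
    refine (integrableOn_deBruijnHBound 0 0).mono' ?_ ?_
    · exact ((continuousOn_deBruijnPhi_Ici.mono Ioi_subset_Ici_self).div hmc.continuousOn
        fun u _ ↦ (hm_pos u).ne').aestronglyMeasurable measurableSet_Ioi
    · refine ae_restrict_of_forall_mem measurableSet_Ioi fun u _ ↦ ?_
      rw [Real.norm_eq_abs, deBruijnHBound, zero_mul, Real.exp_zero, one_mul, zero_mul,
        Real.exp_zero, mul_one, abs_div, abs_of_pos (hm_pos u)]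
      exact div_le_self (abs_nonneg _) (hm1 u)
  have heq : deBruijnHDiv m 0 = ((∫ u in Ioi (0 : ℝ), deBruijnPhi u / m u : ℝ) : ℂ) := by
    rw [deBruijnHDiv, ← integral_complex_ofReal]
    refine setIntegral_congr_fun measurableSet_Ioi fun u _ ↦ ?_
    simp
  rw [heq, Complex.ofReal_ne_zero]
  apply ne_of_gt
  rw [setIntegral_pos_iff_support_of_nonneg_ae
    (ae_restrict_of_forall_mem measurableSet_Ioi fun u hu ↦
      (div_pos (deBruijnPhi_pos_of_nonneg (le_of_lt hu)) (hm_pos u)).le) hintR]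
  have hsupp : Function.support (fun u : ℝ ↦ deBruijnPhi u / m u) ∩ Ioi 0 = Ioi 0 := by
    refine inter_eq_right.2 fun u hu ↦ ?_
    exact (div_pos (deBruijnPhi_pos_of_nonneg (le_of_lt hu)) (hm_pos u)).ne'
  rw [hsupp, Real.volume_Ioi]
  exact ENNReal.zero_lt_top

/-! ## The ODE `(1 − D²/b²) deBruijnHDiv (m·(1+u²/b²)) = deBruijnHDiv m` and the Laguerre step -/

/-- **The ODE of one Laplace factor**: for every `IsDivAdmissible m`, every real `b` and complex `z`,
`F(z) − F''(z)/b² = deBruijnHDiv m z` for `F = deBruijnHDiv (m · (1 + u²/b²))`, because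
`F'' = −∫ u² Φ/(m(1+u²/b²)) cos(zu) du` and `(1 + u²/b²)/(m (1 + u²/b²)) = 1/m`. (For `b = 0`
the factor is `1` by `x/0 = 0`.) [folklore] -/
theorem UniversalFactor.deBruijnHDiv_mul_laplace_sub_deriv_deriv {m : ℝ → ℝ}
    (hm : IsDivAdmissible m) (b : ℝ) (z : ℂ) :
    deBruijnHDiv (fun u : ℝ => m u * (1 + u ^ 2 / b ^ 2)) z -
        deriv (deriv (deBruijnHDiv fun u : ℝ => m u * (1 + u ^ 2 / b ^ 2))) z / b ^ 2 =
      deBruijnHDiv m z := by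
  set m' : ℝ → ℝ := fun u ↦ m u * (1 + u ^ 2 / b ^ 2) with hm'_def
  have hm' : IsDivAdmissible m' := hm.mul (isDivAdmissible_laplace b)
  have hl_pos : ∀ u : ℝ, 0 < 1 + u ^ 2 / b ^ 2 := fun u ↦ by positivity
  rw [hm'.deriv_deriv_deBruijnHDiv, ← divCosMoment_zero, ← divCosMoment_zero]
  simp only [neg_div, sub_neg_eq_add]
  rw [divCosMoment, divCosMoment, divCosMoment, ← integral_div,
    ← integral_add (hm'.integrableOn_divCosIntegrand 0 z)
    ((hm'.integrableOn_divCosIntegrand 2 z).div_const _)]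
  refine setIntegral_congr_fun measurableSet_Ioi fun u _ ↦ ?_
  have key : divWeight m' 0 u + divWeight m' 2 u / b ^ 2 = divWeight m 0 u := by
    simp only [divWeight, pow_zero, one_mul, hm'_def]
    have hL := (hl_pos u).ne'
    calc deBruijnPhi u / (m u * (1 + u ^ 2 / b ^ 2)) +
          u ^ 2 * (deBruijnPhi u / (m u * (1 + u ^ 2 / b ^ 2))) / b ^ 2
        = deBruijnPhi u / (m u * (1 + u ^ 2 / b ^ 2)) * (1 + u ^ 2 / b ^ 2) := by ring
      _ = deBruijnPhi u / m u := by rw [div_mul_eq_mul_div, mul_div_mul_right _ _ hL]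
  simp only [divCosIntegrand]
  rw [← key]
  push_cast
  ring

/-- **The Laguerre step up the universal-factor order.** For continuous `m ≥ 1` and real `b`:
if `deBruijnHDiv (m · (1 + u²/b²))` has only real zeros then so has `deBruijnHDiv m`. With
`F = deBruijnHDiv (m·(1+u²/b²))` (real entire of order `< 2`) put `G = F' + bF`; then
`G' − bG = F'' − b²F = −b² deBruijnHDiv m`. Laguerre's step (`UniversalFactor.laguerre_step`) for
`(F, b)` gives `G ≡ 0` or `G` real-rooted, and for `(G, −b)` gives `G' − bG ≡ 0` or real-rooted;
both degenerate cases would force `deBruijnHDiv m ≡ 0`, contradicting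
`UniversalFactor.deBruijnHDiv_zero_ne_zero`. [folklore] -/
theorem UniversalFactor.hasOnlyRealZeros_deBruijnHDiv_of_mul_laplace {m : ℝ → ℝ}
    (hmc : Continuous m) (hm1 : ∀ u, 1 ≤ m u) (b : ℝ)
    (h : HasOnlyRealZeros (deBruijnHDiv fun u : ℝ => m u * (1 + u ^ 2 / b ^ 2))) :
    HasOnlyRealZeros (deBruijnHDiv m) := by
  rcases eq_or_ne b 0 with rfl | hb
  · have : (fun u : ℝ => m u * (1 + u ^ 2 / (0 : ℝ) ^ 2)) = m := funext fun u ↦ by simp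
    rwa [this] at h
  set m' : ℝ → ℝ := fun u ↦ m u * (1 + u ^ 2 / b ^ 2) with hm'
  have hm'c : Continuous m' := hmc.mul (by fun_prop)
  have hm'1 : ∀ u, 1 ≤ m' u := fun u ↦ by
    have h0 : 0 ≤ u ^ 2 / b ^ 2 := by positivity
    exact one_le_mul_of_one_le_of_one_le (hm1 u) (by linarith)
  set F : ℂ → ℂ := deBruijnHDiv m' with hFdef
  have hzero : ∀ z, F z = 0 → z.im = 0 := h
  have hFd : Differentiable ℂ F :=
    (UniversalFactor.isDivAdmissible_of_one_le hm'c hm'1).differentiable_deBruijnHDiv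
  have hFreal : ∀ x : ℝ, (F x).im = 0 := fun x ↦ deBruijnHDiv_ofReal_im m' x
  obtain ⟨ρ, C, hρ0, hρ, hgr⟩ := UniversalFactor.exists_growth_deBruijnHDiv hm'c hm'1
  -- the intermediate function `G = F' + bF`
  set G : ℂ → ℂ := fun z ↦ deriv F z + (b : ℂ) * F z with hGdef
  have hFd' : Differentiable ℂ (deriv F) := hFd.deriv
  have hGd : Differentiable ℂ G := hFd'.add (hFd.const_mul _)
  have hderivG : ∀ z, deriv G z = deriv (deriv F) z + (b : ℂ) * deriv F z := fun z ↦ by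
    have h := ((hFd' z).hasDerivAt).add (((hFd z).hasDerivAt).const_mul (b : ℂ))
    exact h.deriv
  have hODE : ∀ z, F z - deriv (deriv F) z / (b : ℂ) ^ 2 = deBruijnHDiv m z := fun z ↦ by
    have := UniversalFactor.deBruijnHDiv_mul_laplace_sub_deriv_deriv
      (UniversalFactor.isDivAdmissible_of_one_le hmc hm1) b z
    exact_mod_cast this
  have hb0 : (b : ℂ) ≠ 0 := by exact_mod_cast hb
  have hH : ∀ z, deBruijnHDiv m z = -(deriv G z + (-(b : ℝ) : ℝ) * G z) / (b : ℂ) ^ 2 := by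
    intro z
    rw [← hODE z, hderivG]
    simp only [hGdef]
    push_cast
    field_simp
    ring
  have hz₁ : deBruijnHDiv m 0 ≠ 0 := UniversalFactor.deBruijnHDiv_zero_ne_zero hmc hm1
  have hGreal : ∀ x : ℝ, (G x).im = 0 := fun x ↦ by
    simp only [hGdef, Complex.add_im, Complex.mul_im, Complex.ofReal_re, Complex.ofReal_im,
      zero_mul, add_zero, im_deriv_ofReal hFd hFreal x, hFreal x, mul_zero]
  rcases UniversalFactor.laguerre_step hFd hρ0 hρ hgr hFreal hzero b with hG0 | hGz
  · -- `G ≡ 0` would give `deBruijnHDiv m ≡ 0`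
    exfalso
    apply hz₁
    have hG0' : G = 0 := funext hG0
    rw [hH, hG0']
    simp
  · obtain ⟨ρ', C', hρ'0, hρ', hgr'⟩ :=
      UniversalFactor.exists_growth_deriv_add_mul hFd hρ0 hρ hgr (b : ℂ)
    rcases UniversalFactor.laguerre_step hGd hρ'0 hρ' hgr' hGreal hGz (-b) with hK0 | hKz
    · exfalso
      apply hz₁
      rw [hH, hK0]
      simp
    · intro z hz
      refine hKz z ?_
      have h := hH z
      rw [hz] at h
      have hb2 : (b : ℂ) ^ 2 ≠ 0 := pow_ne_zero 2 hb0
      have := (div_eq_zero_iff.1 h.symm).resolve_right hb2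
      exact neg_eq_zero.1 this

/-! ## The Gaussian step (de Bruijn's Theorem 13 with `Δ = 0`) -/

/-- **The Gaussian step up the universal-factor order.** For continuous `m ≥ 1` and `t ≥ 0`:
if `deBruijnHDiv (m · e^{tu²})` has only real zeros then so has `deBruijnHDiv m`. The kernel of
`deBruijnHDiv m` is the kernel of `deBruijnHDiv (m·e^{tu²})` times the universal factor
`e^{λ²s²/2}`, `λ = √(2t)`, so this is de Bruijn 1950, Thm. 13 (`Δ = 0`) in the form
`DeBruijn1950.rootsInStrip_zero_gaussian`; the non-degeneracy `deBruijnHDiv m ≢ 0` is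
`UniversalFactor.deBruijnHDiv_zero_ne_zero`. [cite: Bruijn1950, Thm. 13] -/
theorem UniversalFactor.hasOnlyRealZeros_deBruijnHDiv_of_mul_exp {m : ℝ → ℝ}
    (hmc : Continuous m) (hm1 : ∀ u, 1 ≤ m u) {t : ℝ} (ht : 0 ≤ t)
    (h : HasOnlyRealZeros (deBruijnHDiv fun u : ℝ => m u * Real.exp (t * u ^ 2))) :
    HasOnlyRealZeros (deBruijnHDiv m) := by
  set m' : ℝ → ℝ := fun u ↦ m u * Real.exp (t * u ^ 2) with hm'
  have hm'c : Continuous m' := hmc.mul (by fun_prop)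
  have hm'1 : ∀ u, 1 ≤ m' u := fun u ↦
    one_le_mul_of_one_le_of_one_le (hm1 u) (Real.one_le_exp (by positivity))
  have hF := UniversalFactor.isAdmissible_divKernel hm'c hm'1
  -- the transform of the kernel of `m'` has only real roots
  have hroots : RootsInStrip (trigIntegral fun s : ℝ ↦ ((Newman.evenPhi s / m' |s| : ℝ) : ℂ)) 0 := by
    rw [rootsInStrip_zero_iff]
    intro z hz
    rw [UniversalFactor.trigIntegral_divKernel hm'c hm'1] at hz
    exact h z ((mul_eq_zero.1 hz).resolve_left two_ne_zero)
  -- the Gaussian-multiplied kernel is the kernel of `m`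
  have hkey : (fun s : ℝ ↦ ((Newman.evenPhi s / m' |s| : ℝ) : ℂ) *
      (Real.exp (Real.sqrt (2 * t) ^ 2 * s ^ 2 / 2) : ℝ)) =
      fun s : ℝ ↦ ((Newman.evenPhi s / m |s| : ℝ) : ℂ) := by
    funext s
    rw [Real.sq_sqrt (by positivity), ← Complex.ofReal_mul]
    congr 1
    simp only [hm', sq_abs]
    rw [show 2 * t * s ^ 2 / 2 = t * s ^ 2 by ring]
    have hexp := Real.exp_pos (t * s ^ 2)
    have hms : m |s| ≠ 0 := by linarith [hm1 |s|]
    field_simp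
  have hne : ∃ z, trigIntegral (fun s : ℝ ↦ ((Newman.evenPhi s / m' |s| : ℝ) : ℂ) *
      (Real.exp (Real.sqrt (2 * t) ^ 2 * s ^ 2 / 2) : ℝ)) z ≠ 0 := by
    refine ⟨0, ?_⟩
    rw [hkey, UniversalFactor.trigIntegral_divKernel hmc hm1]
    exact mul_ne_zero two_ne_zero (UniversalFactor.deBruijnHDiv_zero_ne_zero hmc hm1)
  have hres := DeBruijn1950.rootsInStrip_zero_gaussian hF (Real.sqrt (2 * t)) hroots hne
  rw [hkey, rootsInStrip_zero_iff] at hres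
  intro z hz
  apply hres z
  rw [UniversalFactor.trigIntegral_divKernel hmc hm1, hz, mul_zero]

/-! ## The reduction to the Laplace ray -/

/-- **`MixedFactorReduction`** (route `UniversalFactor`, item stmt-RiemannHypothesis-2580): for
`t ≥ 0`, a multiset `s` of rates and `a ∈ s`, if the transform of
`e^{−tu²} Φ(u) / ∏_{b∈s} (1 + u²/b²)` has only real zeros, then so has the Laplace-smoothed
`F_a(z) = ∫₀^∞ Φ(u)(1 + u²/a²)⁻¹ cos(zu) du`. Proof: the hypothesis is
`HasOnlyRealZeros (deBruijnHDiv (P_s · e^{tu²}))` with `P_s(u) = ∏_{b∈s}(1 + u²/b²) ≥ 1`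
continuous; the Gaussian step (de Bruijn Thm. 13) removes `e^{tu²}`, and writing
`s = a ::ₘ r`, one Laguerre step per element of `r` (multiset induction) removes the factors
`1 + u²/b²`, `b ∈ r`, leaving `deBruijnHDiv (1 + u²/a²) = F_a` (`deBruijnHDiv_laplace_eq`, `rfl`).
The positivity hypothesis on the rates is not needed (`b` enters through `b²` only, and `b = 0`
gives the factor `1` by `x/0 = 0`). [folklore] -/
theorem UniversalFactor.mixedFactorReduction : UniversalFactor.MixedFactorReduction := by
  intro t a s ht ha _ hG
  -- the product multipliers `P r u = ∏_{b ∈ r} (1 + u²/b²)`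
  set P : Multiset ℝ → ℝ → ℝ := fun r u ↦ (r.map fun b => 1 + u ^ 2 / b ^ 2).prod with hP
  have hPc : ∀ r, Continuous (P r) := by
    intro r
    induction r using Multiset.induction_on with
    | empty =>
      simp only [hP, Multiset.map_zero, Multiset.prod_zero]
      exact continuous_const
    | cons b r ih =>
      have e : P (b ::ₘ r) = fun u ↦ (1 + u ^ 2 / b ^ 2) * P r u := by
        funext u; simp only [hP, Multiset.map_cons, Multiset.prod_cons]
      rw [e]
      exact (by fun_prop : Continuous fun u : ℝ => 1 + u ^ 2 / b ^ 2).mul ih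
  have hP1 : ∀ r u, 1 ≤ P r u := by
    intro r u
    induction r using Multiset.induction_on with
    | empty => simp [hP]
    | cons b r ih =>
      have e : P (b ::ₘ r) u = (1 + u ^ 2 / b ^ 2) * P r u := by
        simp only [hP, Multiset.map_cons, Multiset.prod_cons]
      rw [e]
      have h0 : 0 ≤ u ^ 2 / b ^ 2 := by positivity
      exact one_le_mul_of_one_le_of_one_le (by linarith) ih
  -- Step 0: the hypothesis says `deBruijnHDiv (P s · e^{tu²})` has only real zeros
  have hG' : HasOnlyRealZeros (deBruijnHDiv fun u : ℝ => P s u * Real.exp (t * u ^ 2)) := by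
    have heq : (deBruijnHDiv fun u : ℝ => P s u * Real.exp (t * u ^ 2)) = fun z : ℂ =>
        ∫ u in Set.Ioi (0:ℝ), ((Real.exp (-(t * u ^ 2)) * deBruijnPhi u /
          (s.map fun b => 1 + u ^ 2 / b ^ 2).prod : ℝ) : ℂ) * Complex.cos (z * u) := by
      funext z
      rw [deBruijnHDiv]
      refine setIntegral_congr_fun measurableSet_Ioi fun u _ ↦ ?_
      have hPs : (s.map fun b => 1 + u ^ 2 / b ^ 2).prod ≠ 0 := by
        have h1 := hP1 s u
        simp only [hP] at h1
        linarith
      have hexp := Real.exp_pos (t * u ^ 2)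
      congr 2
      simp only [hP]
      rw [Real.exp_neg]
      field_simp
    rw [heq]
    exact hG
  -- Step 1: remove the Gaussian factor (de Bruijn Thm. 13)
  have hK : HasOnlyRealZeros (deBruijnHDiv (P s)) :=
    UniversalFactor.hasOnlyRealZeros_deBruijnHDiv_of_mul_exp (hPc s) (hP1 s) ht hG'
  -- Step 2: remove the Laplace factors of `s ∖ {a}` one at a time (Laguerre)
  obtain ⟨r, rfl⟩ : ∃ r, s = a ::ₘ r := ⟨s.erase a, (Multiset.cons_erase ha).symm⟩
  suffices key : ∀ r : Multiset ℝ, HasOnlyRealZeros (deBruijnHDiv (P (a ::ₘ r))) →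
      HasOnlyRealZeros (deBruijnHDiv fun u : ℝ => 1 + u ^ 2 / a ^ 2) from key r hK
  intro r
  induction r using Multiset.induction_on with
  | empty =>
    intro h
    have e : P (a ::ₘ 0) = fun u : ℝ => 1 + u ^ 2 / a ^ 2 := by
      funext u; simp [hP]
    rwa [e] at h
  | cons b r ih =>
    intro h
    apply ih
    have e : P (a ::ₘ b ::ₘ r) = fun u ↦ P (a ::ₘ r) u * (1 + u ^ 2 / b ^ 2) := by
      funext u
      simp only [hP, Multiset.map_cons, Multiset.prod_cons]
      ring
    rw [e] at h
    exact UniversalFactor.hasOnlyRealZeros_deBruijnHDiv_of_mul_laplace (hPc _) (hP1 _) b h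

end Summit.RiemannHypothesis.RiemannHypothesis.Theorems
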